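import Mathlib
import HarnessLib
import Summits.ValiantsHypothesis.ValiantsHypothesis.Theses.MonotoneRestoration
import Literature.Computability.AlgebraicComplexity.ArithCircuit
import Literature.Computability.AlgebraicComplexity.ArithCircuitProofs
import Literature.Computability.AlgebraicComplexity.MonotoneStructure
import Literature.Computability.AlgebraicComplexity.PermanentIrreducible
import Literature.ModelTheory.FiniteModelTheory.CkEquiv
import Summits.ValiantsHypothesis.ValiantsHypothesis.Theorems.MonotoneRestorationMonotoneRestorationQPCosetCount
import Summits.ValiantsHypothesis.ValiantsHypothesis.Theorems.MonotoneRestorationMonotoneRestorationQPSymmetricLB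
import Summits.ValiantsHypothesis.ValiantsHypothesis.Theorems.MonotoneRestorationMonotoneRestorationQPSupportSymmetrisation
import Summits.ValiantsHypothesis.ValiantsHypothesis.Theorems.MonotoneRestorationMonotoneRestorationQPSparseRegime
import Summits.ValiantsHypothesis.ValiantsHypothesis.Theorems.MonotoneRestorationMonotoneRestorationQPBeta
import Literature.Computability.AlgebraicComplexity.SymmetricArithCircuit
import Literature.Computability.AlgebraicComplexity.DawarWilsenach2025Proofs
import Literature.GroupTheory.PermutationGroups.SmallIndexSubgroups
import Summits.ValiantsHypothesis.ValiantsHypothesis.Theorems.MonotoneRestorationQP.Negative.LoadBearing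
import Summits.ValiantsHypothesis.ValiantsHypothesis.Theorems.MonotoneRestorationMonotoneRestorationQPPermSupportCount

/-! TTRL-lite variant V20095 of stmt-ValiantsHypothesis-15886

Target `stub_gateSupport`, move `lemma_proposal`: the inductive step of a support computation that
propagates from children to parent. An automorphism `π` (extending any `ρ`) that fixes every child
of an internal (`+`/`×`) gate `g` fixes `g` itself, provided `g` has no twin — it is the only gate
with its (label, children) pair. Indeed `π g` has label `ρ • label g = label g` (`+`/`×` are fixed by
the label action) and children `π '' children g = children g`, so twin-freeness gives `π g = g`.
-/

-- `Summit.ValiantsHypothesis.ValiantsHypothesis.…` is the tree's mandated single-conjunct layout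
-- (Sub = Summit), so the duplicated namespace component is intended.
set_option linter.dupNamespace false

namespace Summit.ValiantsHypothesis.ValiantsHypothesis.Theorems

open Summit.ValiantsHypothesis.ValiantsHypothesis.Theses.MonotoneRestoration
open Literature.Computability.AlgebraicComplexity

/-- **TTRL-lite variant V20095 of `stub_gateSupport`** (twin-free internal gates are fixed by any
automorphism fixing their children). In a labelled arithmetic circuit `C` on the variables
`Fin n × Fin n`, if `π` is a circuit automorphism extending `ρ`, `π` fixes every child of `g`, `g` is
a `+` or `×` gate, and `g` is the unique gate with its label and children set, then `π g = g`:
`label (π g) = ρ • label g = label g` (Def. 3.6, `+`/`×` preserved) and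
`children (π g) = π '' children g = children g`.
[cite: DawarWilsenach2025, Def. 3.6] -/
theorem stub_gateSupport_var20095 :
    ∀ (n : ℕ) (K : Type) (G : Type) (C : LabelledArithCircuit K (Fin n × Fin n) Unit G) (g : G)
      (ρ : Equiv.Perm (Fin n)) (π : Equiv.Perm G), C.IsAutomorphismExtending ρ π →
      (∀ h ∈ C.children g, π h = h) →
      (C.label g = CircuitLabel.add ∨ C.label g = CircuitLabel.mul) →
      (∀ g' : G, C.label g' = C.label g → C.children g' = C.children g → g' = g) → π g = g := by
  intro n K G C g ρ π hπ hfix hlab htwin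
  apply htwin (π g)
  · rw [hπ.label_apply]
    rcases hlab with h | h <;> rw [h] <;> rfl
  · rw [hπ.children_apply]
    ext x
    simp only [Finset.mem_map, Equiv.coe_toEmbedding]
    constructor
    · rintro ⟨a, ha, rfl⟩
      rw [hfix a ha]
      exact ha
    · intro hx
      exact ⟨x, hx, hfix x hx⟩

end Summit.ValiantsHypothesis.ValiantsHypothesis.Theorems
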